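import Summits.QuantumFields.BalabanUV.Beta.CompositeVertexWardRootedTwoBricks
import Summits.QuantumFields.BalabanUV.Beta.WardLocusS0N
import Summits.QuantumFields.BalabanUV.Beta.WardLocusQuartic
import Literature.MathematicalPhysics.QuantumFieldTheory.Balaban1983to89.Beta.KernelReflection

/-!
# `BalabanUV.Beta.CompositeVertexWardRootedTwoLetter` — row D1 ∕ (C1), PART 106c: THE (W)_j BORDER LETTER `hBord`∕`hBord''` OF an2 g29's MEMBER-0 MACHINERY
# FOR THE ROOTED COMPOSITE TABLES, REMAINDER ZERO (slot symmetry of the composite second-order kernel + a generic lift of a bond Ward law to the letter)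

HONEST DEPENDENCY (page 1, mandatory): continuum YM on T⁴ ⇐ BetaPertH ∧ nine spine estimates (0/9 proved); BetaPertH ⇐ (D1) ∧ (D4) ∧ CAP+tail;
G-an2-4 gates asym, D1 and NE2/3/4.  HONEST FRAMING (cell contract, verbatim): «discharging `BetaPertH` makes Bałaban's UV stability UNCONDITIONAL —
a real constructive-QFT result; it is NOT the continuum limit and NOT the Clay problem.»  ABSOLUTE RULE (cell charter, verbatim): «No internally-minted
statement may enter as a cited fact. Every hypothesis is either kernel-proved in this package or a verbatim quotation of a PUBLISHED theorem with page
reference. The manuscript(s) under audit are NOT citable for their own disputed steps — they are the thing under adjudication; programme-internal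
(2001/route/tribunal) claims are never citable.»

WHY (row-D1 owner an2 gen 86, `gen86/HWD-SCOPING.md` §1 (border) ∕ §1b).  `WardLocusRecursiveAllSlot.divW_WrecOf_zero_of_letters` (an2 g29) wants, for the second-order border slot, the
letters `hBord` (first background slot) and `hBord''` (second), each with a bounded remainder.  PART 106b proved the BOND law of the anti-twin packed rooted composite second-order
table in its FIRST slot (`divV_atw_compVh2S_rooted_eq_conjV`).  Here: §1 the composite second-order kernel over a SLOT-SYMMETRIC second brick is itself slot-symmetric
(`compVH2Ker_swap`, induction over F5a's chain rule; the packed table inherits it: `atw_compVh2S_rooted_swap`), so the bond law holds in the SECOND slot too; §2 a generic lift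
(`hBord_of_bondLaw`): a pointwise bond law `divV (κ u ↦ B κ u κ′ u′) u₀ = conjV (V κ′ u′) (diagK (legInd ρ u₀))` and the lock `cH·cB = ξ·cVH` give the letter
`cH • Σ_v divV (κ u ↦ cB • B κ u κ′ u′) (N•Y+v) = comp (cVH • V κ′ u′) (diagK (ξ • Σ_v legInd ρ (N•Y+v))) − comp (diagK …) (cVH • V κ′ u′)` with remainder ZERO; §3 both letters for the
rooted composite tables at blocking `L^m`, root `R m` (**`hBord_compB_rooted`**, **`hBord''_compB_rooted`**) — at the record's pins the lock reads `2·cB = cE·cVH` with `ξ = cH·cE∕2`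
(ADD2 §C3: `cB = −Lc¹²∕4 = cE·cVH∕2` at depth 1).

WHAT: [folklore] one induction + kernel algebra BY NAME; no `def`, no `def … : Prop`, nothing cited, 0 sorry.  Nothing of Bałaban's asserted, valued or discharged; 0 estimates;
0∕4 row-D1 binders; (W)_j NOT claimed (its mixed letter, `hD`, the instantiation and the residual glue remain — HWD-SCOPING §1b); NOT (C1), NOT D1, NEVER «G-an2-4 closed»,
NOT BetaPertH, NOT continuum, NOT Clay.  Row D1 ∕ (C1) OWNER «beta-an2», gen 86, 2026-08-30.  No existing file touched.
-/

noncomputable section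

open Finset
open scoped BigOperators
open Literature.MathematicalPhysics.QuantumFieldTheory.Balaban1983to89
open Literature.MathematicalPhysics.QuantumFieldTheory.Balaban1983to89.Beta
open ExpKernelCalculus (MKer comp)
open OneStepResolventKernel (Fib)
open KernelWard (divV)
open AffineAveraging (Site box toSite unitVec)
open AveragingContours (off blk)
open AveragingHessianKernels (Bond Near packVH packVH_inl_inr packVH_inr_inl packVH_inl_inl packVH_inr_inr)
open AveragingHessianKernelsRooted (linKerAt vhKerAt)
open KernelReflection (comp_smul_left comp_smul_right)
open Summit.QuantumFields.BalabanUV.Beta.ChartConjugation (conjV)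
open Summit.QuantumFields.BalabanUV.Beta.BorderedHessian (diagK conjV_diagK_apply)
open Summit.QuantumFields.BalabanUV.Beta.AveragingWardRootedStencils (legInd)
open Summit.QuantumFields.BalabanUV.Beta.SecondOrderSocketIdentification (atw)
open Summit.QuantumFields.BalabanUV.Beta.WardLocusS0N (conjV_diagK_smul conjV_diagK_sum)
open Summit.QuantumFields.BalabanUV.Beta.CompositeVertexKernelRec
open Summit.QuantumFields.BalabanUV.Beta.CompositeVertexKernelBoundsTwoSym (vh2KerSymAt vh2KerSymAt_swap)
open Summit.QuantumFields.BalabanUV.Beta.CompositeVertexWardRootedTwo (sum_pair_comm)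
open Summit.QuantumFields.BalabanUV.Beta.CompositeVertexWardRootedTwoBricks (divV_atw_compVh2S_rooted_eq_conjV)

namespace Summit.QuantumFields.BalabanUV.Beta.CompositeVertexWardRootedTwoLetter

variable {d : ℕ}

/-! ## §1 Slot symmetry of the composite second-order kernel over a slot-symmetric second brick -/

section Swap

variable {ℓ : ℕ → Fin (d + 1) → Site (d + 1) → Bond (d + 1) → ℝ}
  {𝓋 : ℕ → Fin (d + 1) → Site (d + 1) → Bond (d + 1) → Bond (d + 1) → ℝ}
  {𝓋₂ : ℕ → Fin (d + 1) → Site (d + 1) → Bond (d + 1) → Bond (d + 1) → Bond (d + 1) → ℝ} {L : ℕ}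
  (h𝓋₂s : ∀ k μ y g g₁ g₂, 𝓋₂ k μ y g g₁ g₂ = 𝓋₂ k μ y g g₂ g₁)

include h𝓋₂s in
/-- [folklore] **THE COMPOSITE SECOND-ORDER BORDER KERNEL OVER A SLOT-SYMMETRIC SECOND BRICK IS SLOT-SYMMETRIC** (induction over F5a's four-summand chain rule: summand 1 by the
brick's symmetry and one binder-pair swap, summands 2 ↔ 3 exchanged, summand 4 by the hypothesis of induction). -/
theorem compVH2Ker_swap : ∀ (m : ℕ) (μ : Fin (d + 1)) (y : Site (d + 1)) (f b b' : Bond (d + 1)),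
    compVH2Ker ℓ 𝓋 𝓋₂ L m μ y f b b' = compVH2Ker ℓ 𝓋 𝓋₂ L m μ y f b' b
  | 0, μ, y, f, b, b' => by simp only [compVH2Ker_zero]
  | m + 1, μ, y, f, b, b' => by
    rw [compVH2Ker_succ, compVH2Ker_succ]
    have h1 : (∑ κ : Fin (d + 1), ∑ e ∈ offs L, ∑ κ' : Fin (d + 1), ∑ e' ∈ offs L, ∑ κ'' : Fin (d + 1), ∑ e'' ∈ offs L,
          𝓋₂ m μ y (κ, (L : ℤ) • y + e) (κ', (L : ℤ) • y + e') (κ'', (L : ℤ) • y + e'')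
            * compLinKer ℓ L m f (κ, (L : ℤ) • y + e) * compLinKer ℓ L m b (κ', (L : ℤ) • y + e')
            * compLinKer ℓ L m b' (κ'', (L : ℤ) • y + e'')) =
        ∑ κ : Fin (d + 1), ∑ e ∈ offs L, ∑ κ' : Fin (d + 1), ∑ e' ∈ offs L, ∑ κ'' : Fin (d + 1), ∑ e'' ∈ offs L,
          𝓋₂ m μ y (κ, (L : ℤ) • y + e) (κ', (L : ℤ) • y + e') (κ'', (L : ℤ) • y + e'')
            * compLinKer ℓ L m f (κ, (L : ℤ) • y + e) * compLinKer ℓ L m b' (κ', (L : ℤ) • y + e')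
            * compLinKer ℓ L m b (κ'', (L : ℤ) • y + e'') := by
      refine Finset.sum_congr rfl fun κ _ => Finset.sum_congr rfl fun e _ => ?_
      rw [sum_pair_comm L (fun κ' e' κ'' e'' =>
        𝓋₂ m μ y (κ, (L : ℤ) • y + e) (κ', (L : ℤ) • y + e') (κ'', (L : ℤ) • y + e'')
          * compLinKer ℓ L m f (κ, (L : ℤ) • y + e) * compLinKer ℓ L m b (κ', (L : ℤ) • y + e')
          * compLinKer ℓ L m b' (κ'', (L : ℤ) • y + e''))]
      refine Finset.sum_congr rfl fun κ'' _ => Finset.sum_congr rfl fun e'' _ => Finset.sum_congr rfl fun κ' _ => Finset.sum_congr rfl fun e' _ => ?_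
      rw [h𝓋₂s m μ y (κ, (L : ℤ) • y + e) (κ', (L : ℤ) • y + e') (κ'', (L : ℤ) • y + e'')]
      ring
    have h4 : (∑ κ : Fin (d + 1), ∑ e ∈ offs L, ℓ m μ y (κ, (L : ℤ) • y + e) * compVH2Ker ℓ 𝓋 𝓋₂ L m κ ((L : ℤ) • y + e) f b b') =
        ∑ κ : Fin (d + 1), ∑ e ∈ offs L, ℓ m μ y (κ, (L : ℤ) • y + e) * compVH2Ker ℓ 𝓋 𝓋₂ L m κ ((L : ℤ) • y + e) f b' b :=
      Finset.sum_congr rfl fun κ _ => Finset.sum_congr rfl fun e _ => by rw [compVH2Ker_swap m κ ((L : ℤ) • y + e) f b b']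
    rw [h1, h4]
    ring

/-- [folklore] **THE PACKED ROOTED COMPOSITE SECOND-ORDER TABLE IS SYMMETRIC IN ITS TWO BACKGROUND BONDS** (anti-twin packed over F5c's `compVh2S` with the slot-symmetrised
brick `vh2KerSymAt`). -/
theorem atw_compVh2S_rooted_swap {r : ℕ → Fin (d + 1) → ℕ} (m : ℕ) (κ : Fin (d + 1)) (u : Site (d + 1)) (κ' : Fin (d + 1)) (u' : Site (d + 1)) :
    atw (compVh2S (fun k => linKerAt (toSite (r k)) L) (fun k => vhKerAt (toSite (r k)) L) (fun k => vh2KerSymAt (toSite (r k)) L) L m κ u κ' u') =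
      atw (compVh2S (fun k => linKerAt (toSite (r k)) L) (fun k => vhKerAt (toSite (r k)) L) (fun k => vh2KerSymAt (toSite (r k)) L) L m κ' u' κ u) := by
  have hs := compVH2Ker_swap (ℓ := fun k => linKerAt (toSite (r k)) L) (𝓋 := fun k => vhKerAt (toSite (r k)) L)
    (𝓋₂ := fun k => vh2KerSymAt (toSite (r k)) L) (L := L) (fun k μ y g g₁ g₂ => (vh2KerSymAt_swap (toSite (r k)) L μ y g g₁ g₂).symm)
  funext x z a b
  rcases a with β | m₀ <;> rcases b with β' | μ
  · rfl
  · simp only [atw, compVh2S, packVH_inl_inr, hs m μ (blk (L ^ m) z) (β, x) (κ, u) (κ', u')]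
  · simp only [atw, compVh2S, packVH_inl_inr, hs m m₀ (blk (L ^ m) x) (β', z) (κ, u) (κ', u')]
  · rfl

end Swap

/-! ## §2 The generic lift: a pointwise bond Ward law + the lock give the letter, remainder zero -/

section Lift

variable {N : ℕ} (ρ : Site (d + 1)) {B : Fin (d + 1) → Site (d + 1) → Fin (d + 1) → Site (d + 1) → MKer (d + 1) (Fib d)}
  {V : Fin (d + 1) → Site (d + 1) → MKer (d + 1) (Fib d)}

/-- [folklore] **THE LIFT, FIRST SLOT**: from the bond law `divV (κ u ↦ B κ u κ′ u′) u₀ = conjV (V κ′ u′) (diagK (legInd ρ u₀))` and the lock `cH·cB = ξ·cVH`: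
`cH • Σ_v divV (κ u ↦ cB • B κ u κ′ u′) (N•Y+v) = comp (cVH • V κ′ u′) (diagK (ξ • Σ_v legInd ρ (N•Y+v))) − comp (diagK (ξ • Σ_v legInd ρ (N•Y+v))) (cVH • V κ′ u′)`. -/
theorem hBord_of_bondLaw (hbond : ∀ (κ' : Fin (d + 1)) (u' u₀ : Site (d + 1)), divV (fun κ u => B κ u κ' u') u₀ = conjV (V κ' u') (diagK (legInd ρ u₀)))
    {cH cB cVH ξ : ℝ} (hlock : cH * cB = ξ * cVH) (Y : Site (d + 1)) (κ' : Fin (d + 1)) (u' : Site (d + 1)) :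
    cH • ∑ v ∈ box (d + 1) N, divV (fun κ u => cB • B κ u κ' u') ((N : ℤ) • Y + toSite v) =
      comp (cVH • V κ' u') (diagK (ξ • ∑ v ∈ box (d + 1) N, legInd ρ ((N : ℤ) • Y + toSite v))) -
        comp (diagK (ξ • ∑ v ∈ box (d + 1) N, legInd ρ ((N : ℤ) • Y + toSite v))) (cVH • V κ' u') := by
  set S : Site (d + 1) → Fib d → ℝ := ∑ v ∈ box (d + 1) N, legInd ρ ((N : ℤ) • Y + toSite v) with hS
  have e1 : ∀ v ∈ box (d + 1) N, divV (fun κ u => cB • B κ u κ' u') ((N : ℤ) • Y + toSite v) = cB • conjV (V κ' u') (diagK (legInd ρ ((N : ℤ) • Y + toSite v))) := by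
    intro v _
    rw [WardLocusQuartic.divV_smul, hbond]
  rw [Finset.sum_congr rfl e1, ← Finset.smul_sum, smul_smul, ← conjV_diagK_sum, hlock, KernelReflection.comp_smul_left, KernelReflection.comp_smul_right,
    ← smul_sub, ← hS, show comp (V κ' u') (diagK (ξ • S)) - comp (diagK (ξ • S)) (V κ' u') = conjV (V κ' u') (diagK (ξ • S)) from rfl,
    conjV_diagK_smul, smul_smul, mul_comm ξ cVH]

/-- [folklore] **THE LIFT, SECOND SLOT** (the table symmetric in its two background bonds). -/
theorem hBord''_of_bondLaw (hbond : ∀ (κ' : Fin (d + 1)) (u' u₀ : Site (d + 1)), divV (fun κ u => B κ u κ' u') u₀ = conjV (V κ' u') (diagK (legInd ρ u₀)))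
    (hBs : ∀ κ u κ' u', B κ u κ' u' = B κ' u' κ u) {cH cB cVH ξ : ℝ} (hlock : cH * cB = ξ * cVH) (Y : Site (d + 1)) (κ : Fin (d + 1)) (u : Site (d + 1)) :
    cH • ∑ v ∈ box (d + 1) N, divV (fun κ' u' => cB • B κ u κ' u') ((N : ℤ) • Y + toSite v) =
      comp (cVH • V κ u) (diagK (ξ • ∑ v ∈ box (d + 1) N, legInd ρ ((N : ℤ) • Y + toSite v))) -
        comp (diagK (ξ • ∑ v ∈ box (d + 1) N, legInd ρ ((N : ℤ) • Y + toSite v))) (cVH • V κ u) := by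
  have e : (fun κ' u' => cB • B κ u κ' u') = fun κ' u' => cB • B κ' u' κ u := by
    funext κ' u'; rw [hBs]
  rw [e]
  exact hBord_of_bondLaw ρ hbond hlock Y κ u

end Lift

/-! ## §3 The two border letters for the rooted composite tables at blocking `L^m`, remainder zero -/

section Rooted

variable {L : ℕ} {r : ℕ → Fin (d + 1) → ℕ}

/-- [folklore] **`hBordᴿ` — THE (W)_j BORDER LETTER, FIRST SLOT, FOR THE ROOTED COMPOSITE TABLES, REMAINDER ZERO** (in-block roots, `1 ≤ L`, depth `m`, root `R m = Σ_{k<m} L^k • toSite (r k)`,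
lock `cH·cB = ξ·cVH`): the letter `hBord` of `WardLocusRecursiveAllSlot.divW_WrecOf_zero_of_letters` at `Lc := L^m`, `vh₂S := atw (compVh2S …)`, `V := compVhS …`, `RB := 0`. -/
theorem hBord_compB_rooted (hL : 1 ≤ L) (hr : ∀ k, r k ∈ box (d + 1) L) (m : ℕ) {cH cB cVH ξ : ℝ} (hlock : cH * cB = ξ * cVH)
    (Y : Site (d + 1)) (κ' : Fin (d + 1)) (u' : Site (d + 1)) :
    cH • ∑ v ∈ box (d + 1) (L ^ m), divV (fun κ u => cB • atw (compVh2S (fun k => linKerAt (toSite (r k)) L) (fun k => vhKerAt (toSite (r k)) L)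
        (fun k => vh2KerSymAt (toSite (r k)) L) L m κ u κ' u')) (((L ^ m : ℕ) : ℤ) • Y + toSite v) =
      comp (cVH • compVhS (fun k => linKerAt (toSite (r k)) L) (fun k => vhKerAt (toSite (r k)) L) L m κ' u')
          (diagK (ξ • ∑ v ∈ box (d + 1) (L ^ m), legInd (∑ k ∈ Finset.range m, ((L ^ k : ℕ) : ℤ) • toSite (r k)) (((L ^ m : ℕ) : ℤ) • Y + toSite v))) -
        comp (diagK (ξ • ∑ v ∈ box (d + 1) (L ^ m), legInd (∑ k ∈ Finset.range m, ((L ^ k : ℕ) : ℤ) • toSite (r k)) (((L ^ m : ℕ) : ℤ) • Y + toSite v)))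
          (cVH • compVhS (fun k => linKerAt (toSite (r k)) L) (fun k => vhKerAt (toSite (r k)) L) L m κ' u') :=
  hBord_of_bondLaw _ (fun κ' u' u₀ => divV_atw_compVh2S_rooted_eq_conjV hL hr m κ' u' u₀) hlock Y κ' u'

/-- [folklore] **`hBord''ᴿ` — THE SAME IN THE SECOND SLOT** (the packed table is symmetric in its two background bonds, §1). -/
theorem hBord''_compB_rooted (hL : 1 ≤ L) (hr : ∀ k, r k ∈ box (d + 1) L) (m : ℕ) {cH cB cVH ξ : ℝ} (hlock : cH * cB = ξ * cVH)
    (Y : Site (d + 1)) (κ : Fin (d + 1)) (u : Site (d + 1)) :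
    cH • ∑ v ∈ box (d + 1) (L ^ m), divV (fun κ' u' => cB • atw (compVh2S (fun k => linKerAt (toSite (r k)) L) (fun k => vhKerAt (toSite (r k)) L)
        (fun k => vh2KerSymAt (toSite (r k)) L) L m κ u κ' u')) (((L ^ m : ℕ) : ℤ) • Y + toSite v) =
      comp (cVH • compVhS (fun k => linKerAt (toSite (r k)) L) (fun k => vhKerAt (toSite (r k)) L) L m κ u)
          (diagK (ξ • ∑ v ∈ box (d + 1) (L ^ m), legInd (∑ k ∈ Finset.range m, ((L ^ k : ℕ) : ℤ) • toSite (r k)) (((L ^ m : ℕ) : ℤ) • Y + toSite v))) -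
        comp (diagK (ξ • ∑ v ∈ box (d + 1) (L ^ m), legInd (∑ k ∈ Finset.range m, ((L ^ k : ℕ) : ℤ) • toSite (r k)) (((L ^ m : ℕ) : ℤ) • Y + toSite v)))
          (cVH • compVhS (fun k => linKerAt (toSite (r k)) L) (fun k => vhKerAt (toSite (r k)) L) L m κ u) :=
  hBord''_of_bondLaw _ (fun κ' u' u₀ => divV_atw_compVh2S_rooted_eq_conjV hL hr m κ' u' u₀) (fun κ u κ' u' => atw_compVh2S_rooted_swap m κ u κ' u') hlock Y κ u

end Rooted

end Summit.QuantumFields.BalabanUV.Beta.CompositeVertexWardRootedTwoLetter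

end
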